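/-
Copyright (c) 2026 the pub-hodgecm-mathlib formalisation cell (harness21).  Prover seat hodgecm-mathlib-K2E4-p08 (g2), Track B «K2-LIT» ∕ h413,
‹S› ROAD J brick J2♯, RAMIFIED LEAF 2b: index inequality, central scalars, and the letter with its negative central value at a ramified place.  2026-09-04.
-/
import Literature.NumberTheory.Rogawski1990.RankOneEulerPoincareNonsplitCentralValueRamifiedWitnesses   -- ★ (this seat) leaf 2a: the one-place coset witnesses
import HarnessLib

/-!
# (R2♯) at the RAMIFIED non-split places, II: `1∕vol K♯ + 1∕vol K < 1∕vol (K♯ ⊓ K)`, central scalars, and the letter with its negative value — road J, J2♯, leaf 2b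

`L` CM, `v` a finite place of `L⁺` RAMIFIED in `L`, `w ∣ v`, `w̄ = w`, `η` a uniformiser of `L_w`, `D_η = diag(1, η)`; levels `K♯ = K♯_{D_η}`, `K = U(Φ₂)(𝒪_v)`,
`K♯ ⊓ K` of `U₂ = U(Φ₂)(L⁺_v)` (★ `RankOneEulerPoincareNonsplitRamifiedPackage`).  §1 transports the one-place witnesses of leaf 2a along the one-place model
`e_w` (★ `localNonsplitEquiv`) and feeds ★ `toReal_inv_add_toReal_inv_lt_of_witnesses` (p855541) in the orientation dictated by the anti-fixed dichotomy
(★ `exists_units_galAdicCompletionMap_complexConj_eq_neg_of_ramified`): **`ν(K♯)⁻¹ + ν(K)⁻¹ < ν(K♯ ⊓ K)⁻¹`** for every Haar `ν`.  §2: a central unit scalar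
`z = a·1 ∈ U₂` lies in `K♯_D`, `K` and `K♯_D ⊓ K` (any `D`: unitarity gives `|a_w| = 1`, and `D⁻¹ (a_w·1) D = a_w·1`).  §3: from Kottwitz's relations (E) and (N)
at `(K♯, K, K♯ ⊓ K)` (tokens of ★ `exists_epRelations_of_vertexEdgeLevels` at `D := D_η`) the glue WITH VALUE ★
`exists_isLocSmooth_classOrbitalIntegral_eq_one_zero_and_apply_neg_of_relations` (p855520) yields **`f ∈ C_c^∞(U₂)` with orbital integrals `1 ∕ 0` on the regular
elliptic ∕ split classes and `f(a·1) = −r`, one `r > 0`, at every central unit scalar** — the ramified twin of ★ p855639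
`exists_isLocSmooth_classOrbitalIntegral_eq_one_zero_and_apply_neg_of_unramified`.  [Kottwitz1988, §2 Thm 2; Rogawski1990, §12.6 p. 174, §8.1 p. 117;
Serre1980Trees, II.1.3; Tits1979, §2.7.]

HONEST LABEL: a Literature-side helper toward h413 (`stmt-HodgeConjecture-24833`); HC_CM is proved only modulo its printed citations until rung 0 closes.
-/

set_option autoImplicit false

noncomputable section

open scoped ValuativeRel Matrix MatrixGroups ENNReal
open Matrix NumberField IsDedekindDomain MulAction MeasureTheory Measure

namespace Literature.NumberTheory.Rogawski1990

open Literature.NumberTheory.Automorphic Literature.NumberTheory.Automorphic.UnitaryGroup Literature.NumberTheory.GaloisRepresentations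
open Literature.MeasureTheory.Group
open Literature.NumberTheory.Automorphic.HermitianLatticeTree (mem_glInt_iff_forall_v_le_one_and_v_det_eq_one)

section Ramified

variable (L : Type) [Field L] [NumberField L] [IsCMField L] {v : HeightOneSpectrum (𝓞 ↥(maximalRealSubfield L))}
  (w : PlacesOver L v) (hw : IsCMField.complexConj L • w.1 = w.1)

variable
  [MeasurableSpace ((cmDatum L 2 (Matrix.of fun i j : Fin 2 => if i.val + j.val + 1 = 2 then (1 : L) else 0)).Local v)] [BorelSpace ((cmDatum L 2 (Matrix.of fun i j : Fin 2 => if i.val + j.val + 1 = 2 then (1 : L) else 0)).Local v)]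
  (ν : Measure ((cmDatum L 2 (Matrix.of fun i j : Fin 2 => if i.val + j.val + 1 = 2 then (1 : L) else 0)).Local v)) [IsHaarMeasure ν]

/-! ## §1 The index inequality at a ramified place -/

set_option maxHeartbeats 800000 in  -- HB: six one-place witnesses are transported along `localNonsplitEquiv` (definitional `cmDatum.Local` ≡ one-place carrier unfoldings)
/-- **`ν(K♯_η)⁻¹ + ν(K)⁻¹ < ν(K♯_η ⊓ K)⁻¹` AT A RAMIFIED PLACE** (`η` any uniformiser of `L_w`): by the anti-fixed dichotomy one of `K`, `K♯_η` has three pairwise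
`(K♯_η ⊓ K)`-inequivalent elements and the other one element off the flag level (leaf 2a), transported along `e_w`; then Haar coset counting.
[cite: Kottwitz1988, §2 Theorem 2] [cite: Serre1980Trees, II.1.3] [cite: Tits1979, §2.7] -/
theorem toReal_inv_add_toReal_inv_lt_of_ramified (he : v.asIdeal.ramificationIdx' w.1.asIdeal ≠ 1)
    (η : (w.1.adicCompletion L)ˣ) (hη : Valued.v (η : w.1.adicCompletion L) = WithZero.exp (-1 : ℤ)) :
    (ν ((((glInt 2 (w.1.adicCompletion L)).map (MulAut.conj (glDiagonal 2 (w.1.adicCompletion L) ![1, η])).toMonoidHom).comap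
          (((unitaryGroupOfForm (galAdicCompletionMap (L := L) (IsCMField.complexConj L) hw) (placeForm (Matrix.of fun i j : Fin 2 => if i.val + j.val + 1 = 2 then (1 : L) else 0) w.1)).subtype.comp
            (localNonsplitEquiv (IsCMField.complexConj L) (Matrix.of fun i j : Fin 2 => if i.val + j.val + 1 = 2 then (1 : L) else 0)
          (IsCMField.complexConj_ne_one L) w hw).toMonoidHom :
            (cmDatum L 2 (Matrix.of fun i j : Fin 2 => if i.val + j.val + 1 = 2 then (1 : L) else 0)).Local v →* GL (Fin 2) (w.1.adicCompletion L)))) :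
        Set ((cmDatum L 2 (Matrix.of fun i j : Fin 2 => if i.val + j.val + 1 = 2 then (1 : L) else 0)).Local v))).toReal⁻¹ +
      (ν (cmLocalIntegralLevel L 2 (Matrix.of fun i j : Fin 2 => if i.val + j.val + 1 = 2 then (1 : L) else 0) v : Set ((cmDatum L 2 (Matrix.of fun i j : Fin 2 => if i.val + j.val + 1 = 2 then (1 : L) else 0)).Local v))).toReal⁻¹ <
      (ν (((((glInt 2 (w.1.adicCompletion L)).map (MulAut.conj (glDiagonal 2 (w.1.adicCompletion L) ![1, η])).toMonoidHom).comap
          (((unitaryGroupOfForm (galAdicCompletionMap (L := L) (IsCMField.complexConj L) hw) (placeForm (Matrix.of fun i j : Fin 2 => if i.val + j.val + 1 = 2 then (1 : L) else 0) w.1)).subtype.comp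
            (localNonsplitEquiv (IsCMField.complexConj L) (Matrix.of fun i j : Fin 2 => if i.val + j.val + 1 = 2 then (1 : L) else 0)
          (IsCMField.complexConj_ne_one L) w hw).toMonoidHom :
            (cmDatum L 2 (Matrix.of fun i j : Fin 2 => if i.val + j.val + 1 = 2 then (1 : L) else 0)).Local v →* GL (Fin 2) (w.1.adicCompletion L)))) ⊓
            cmLocalIntegralLevel L 2 (Matrix.of fun i j : Fin 2 => if i.val + j.val + 1 = 2 then (1 : L) else 0) v : Subgroup ((cmDatum L 2 (Matrix.of fun i j : Fin 2 => if i.val + j.val + 1 = 2 then (1 : L) else 0)).Local v)) : Set ((cmDatum L 2 (Matrix.of fun i j : Fin 2 => if i.val + j.val + 1 = 2 then (1 : L) else 0)).Local v))).toReal⁻¹ := by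
  classical
  obtain ⟨hSc, -⟩ := isCompact_isOpen_comap_map_conj_glInt L w hw (glDiagonal 2 (w.1.adicCompletion L) ![1, η])
  obtain ⟨hKc, -⟩ := isCompact_isOpen_cmLocalIntegralLevel L 2 (Matrix.of fun i j : Fin 2 => if i.val + j.val + 1 = 2 then (1 : L) else 0) v
  obtain ⟨-, hIo⟩ := isCompact_isOpen_comap_map_conj_glInt_inf_cmLocalIntegralLevel L w hw (glDiagonal 2 (w.1.adicCompletion L) ![1, η])
  have hI0 := hIo.measure_pos ν ⟨1, Subgroup.one_mem _⟩
  -- transport along the one-place model `e_w`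
  set e := localNonsplitEquiv (IsCMField.complexConj L) (Matrix.of fun i j : Fin 2 => if i.val + j.val + 1 = 2 then (1 : L) else 0) (IsCMField.complexConj_ne_one L) w hw with hedef
  have hK : ∀ k : (cmDatum L 2 (Matrix.of fun i j : Fin 2 => if i.val + j.val + 1 = 2 then (1 : L) else 0)).Local v, k ∈ cmLocalIntegralLevel L 2 (Matrix.of fun i j : Fin 2 => if i.val + j.val + 1 = 2 then (1 : L) else 0) v ↔
      ((e k : ↥(unitaryGroupOfForm (galAdicCompletionMap (L := L) (IsCMField.complexConj L) hw) (placeForm (Matrix.of fun i j : Fin 2 => if i.val + j.val + 1 = 2 then (1 : L) else 0) w.1))) : GL (Fin 2) (w.1.adicCompletion L)) ∈ glInt 2 (w.1.adicCompletion L) :=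
    fun k => mem_localIntegralLevel_iff_of_smul_eq (IsCMField.complexConj L) 2 _ (IsCMField.complexConj_ne_one L) w hw k
  have hS : ∀ k : (cmDatum L 2 (Matrix.of fun i j : Fin 2 => if i.val + j.val + 1 = 2 then (1 : L) else 0)).Local v, k ∈ (((glInt 2 (w.1.adicCompletion L)).map (MulAut.conj (glDiagonal 2 (w.1.adicCompletion L) ![1, η])).toMonoidHom).comap
          (((unitaryGroupOfForm (galAdicCompletionMap (L := L) (IsCMField.complexConj L) hw) (placeForm (Matrix.of fun i j : Fin 2 => if i.val + j.val + 1 = 2 then (1 : L) else 0) w.1)).subtype.comp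
            (localNonsplitEquiv (IsCMField.complexConj L) (Matrix.of fun i j : Fin 2 => if i.val + j.val + 1 = 2 then (1 : L) else 0)
          (IsCMField.complexConj_ne_one L) w hw).toMonoidHom :
            (cmDatum L 2 (Matrix.of fun i j : Fin 2 => if i.val + j.val + 1 = 2 then (1 : L) else 0)).Local v →* GL (Fin 2) (w.1.adicCompletion L)))) ↔
      ((e k : ↥(unitaryGroupOfForm (galAdicCompletionMap (L := L) (IsCMField.complexConj L) hw) (placeForm (Matrix.of fun i j : Fin 2 => if i.val + j.val + 1 = 2 then (1 : L) else 0) w.1))) : GL (Fin 2) (w.1.adicCompletion L)) ∈ (glInt 2 (w.1.adicCompletion L)).map (MulAut.conj (glDiagonal 2 (w.1.adicCompletion L) ![1, η])).toMonoidHom :=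
    fun k => mem_comap_map_conj_glInt_iff L w hw (glDiagonal 2 (w.1.adicCompletion L) ![1, η]) k
  have hquot : ∀ u u' : ↥(unitaryGroupOfForm (galAdicCompletionMap (L := L) (IsCMField.complexConj L) hw) (placeForm (Matrix.of fun i j : Fin 2 => if i.val + j.val + 1 = 2 then (1 : L) else 0) w.1)),
      ((e ((e.symm u)⁻¹ * e.symm u') : ↥(unitaryGroupOfForm (galAdicCompletionMap (L := L) (IsCMField.complexConj L) hw) (placeForm (Matrix.of fun i j : Fin 2 => if i.val + j.val + 1 = 2 then (1 : L) else 0) w.1))) : GL (Fin 2) (w.1.adicCompletion L)) = ((u⁻¹ * u' : ↥(unitaryGroupOfForm (galAdicCompletionMap (L := L) (IsCMField.complexConj L) hw) (placeForm (Matrix.of fun i j : Fin 2 => if i.val + j.val + 1 = 2 then (1 : L) else 0) w.1))) : GL (Fin 2) (w.1.adicCompletion L)) := by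
    intro u u'; rw [map_mul, map_inv, e.apply_symm_apply, e.apply_symm_apply]
  obtain ⟨α, hσα, hvα | hvα⟩ := exists_units_galAdicCompletionMap_complexConj_eq_neg_of_ramified L w hw he
  · -- `α` an anti-fixed UNIT: three `K♯`-inequivalent elements of `K`, one element of `K♯ ∖ K`
    obtain ⟨u₂, u₃, x, hu₂, hu₃, hn₂, hn₃, hn₂₃, hx, hxn⟩ := exists_onePlaceWitnesses_of_antifixed_unit L w hw η hη hσα hvα
    rw [add_comm]
    refine toReal_inv_add_toReal_inv_lt_of_witnesses ν inf_le_right inf_le_left hIo.measurableSet hI0 hKc.measure_lt_top hSc.measure_lt_top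
      (k₁ := 1) (k₂ := (e.symm u₂ : (cmDatum L 2 (Matrix.of fun i j : Fin 2 => if i.val + j.val + 1 = 2 then (1 : L) else 0)).Local v)) (k₃ := (e.symm u₃ : (cmDatum L 2 (Matrix.of fun i j : Fin 2 => if i.val + j.val + 1 = 2 then (1 : L) else 0)).Local v)) (x := (e.symm x : (cmDatum L 2 (Matrix.of fun i j : Fin 2 => if i.val + j.val + 1 = 2 then (1 : L) else 0)).Local v))
      (Subgroup.one_mem _) ?_ ?_ ?_ ?_ ?_ ?_ ?_
    · rw [hK, e.apply_symm_apply]; exact hu₂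
    · rw [hK, e.apply_symm_apply]; exact hu₃
    · rw [inv_one, one_mul]; exact fun h => hn₂ (by have h1 := (Subgroup.mem_inf.1 h).1; rwa [hS, e.apply_symm_apply] at h1)
    · rw [inv_one, one_mul]; exact fun h => hn₃ (by have h1 := (Subgroup.mem_inf.1 h).1; rwa [hS, e.apply_symm_apply] at h1)
    · exact fun h => hn₂₃ (by have h1 := (Subgroup.mem_inf.1 h).1; rw [hS] at h1; rw [← hquot]; exact h1)
    · rw [hS, e.apply_symm_apply]; exact hx
    · exact fun h => hxn (by have h1 := (Subgroup.mem_inf.1 h).2; rwa [hK, e.apply_symm_apply] at h1)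
  · -- `α` an anti-fixed UNIFORMISER: three `K`-inequivalent elements of `K♯`, one element of `K ∖ K♯`
    have hσb : galAdicCompletionMap (L := L) (IsCMField.complexConj L) hw ((α : w.1.adicCompletion L)⁻¹) = -((α : w.1.adicCompletion L)⁻¹) := by
      rw [map_inv₀, hσα]; ring
    have hvb : Valued.v ((α : w.1.adicCompletion L)⁻¹) = WithZero.exp (1 : ℤ) := by
      rw [map_inv₀, hvα, ← WithZero.exp_neg]; norm_num
    obtain ⟨u₂, u₃, x, hu₂, hu₃, hn₂, hn₃, hn₂₃, hx, hxn⟩ := exists_onePlaceWitnesses_of_antifixed_inv_uniformizer L w hw η hη hσb hvb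
    refine toReal_inv_add_toReal_inv_lt_of_witnesses ν inf_le_left inf_le_right hIo.measurableSet hI0 hSc.measure_lt_top hKc.measure_lt_top
      (k₁ := 1) (k₂ := (e.symm u₂ : (cmDatum L 2 (Matrix.of fun i j : Fin 2 => if i.val + j.val + 1 = 2 then (1 : L) else 0)).Local v)) (k₃ := (e.symm u₃ : (cmDatum L 2 (Matrix.of fun i j : Fin 2 => if i.val + j.val + 1 = 2 then (1 : L) else 0)).Local v)) (x := (e.symm x : (cmDatum L 2 (Matrix.of fun i j : Fin 2 => if i.val + j.val + 1 = 2 then (1 : L) else 0)).Local v))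
      (Subgroup.one_mem _) ?_ ?_ ?_ ?_ ?_ ?_ ?_
    · rw [hS, e.apply_symm_apply]; exact hu₂
    · rw [hS, e.apply_symm_apply]; exact hu₃
    · rw [inv_one, one_mul]; exact fun h => hn₂ (by have h1 := (Subgroup.mem_inf.1 h).2; rwa [hK, e.apply_symm_apply] at h1)
    · rw [inv_one, one_mul]; exact fun h => hn₃ (by have h1 := (Subgroup.mem_inf.1 h).2; rwa [hK, e.apply_symm_apply] at h1)
    · exact fun h => hn₂₃ (by have h1 := (Subgroup.mem_inf.1 h).2; rw [hK] at h1; rw [← hquot]; exact h1)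
    · rw [hK, e.apply_symm_apply]; exact hx
    · exact fun h => hxn (by have h1 := (Subgroup.mem_inf.1 h).1; rwa [hS, e.apply_symm_apply] at h1)

/-! ## §2 (W1) Central unit scalars lie in `K♯_D`, `K` and `K♯_D ⊓ K` -/

omit [MeasurableSpace ((cmDatum L 2 (Matrix.of fun i j : Fin 2 => if i.val + j.val + 1 = 2 then (1 : L) else 0)).Local v)] [BorelSpace ((cmDatum L 2 (Matrix.of fun i j : Fin 2 => if i.val + j.val + 1 = 2 then (1 : L) else 0)).Local v)] in
/-- (W1) **a central unit scalar `z = a·1 ∈ U₂` lies in `K♯_D`, `K` and `K♯_D ⊓ K`** (any `D ∈ GL₂(L_w)`): unitarity forces `σ_w(a_w) a_w = 1`, so `a_w·1 ∈ GL₂(𝒪_w)`,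
and `D⁻¹ (a_w·1) D = a_w·1`. [cite: Rogawski1990, §1.10 p. 9] [cite: Kottwitz1988, §2] -/
theorem scalar_mem_vertexEdgeLevels (D : GL (Fin 2) (w.1.adicCompletion L))
    (z : (cmDatum L 2 (Matrix.of fun i j : Fin 2 => if i.val + j.val + 1 = 2 then (1 : L) else 0)).Local v) (a : LocalRing L v)
    (hz : ((z.val : GL (Fin 2) (LocalRing L v)).val : Matrix (Fin 2) (Fin 2) (LocalRing L v)) = a • (1 : Matrix (Fin 2) (Fin 2) (LocalRing L v))) :
    z ∈ (((glInt 2 (w.1.adicCompletion L)).map (MulAut.conj D).toMonoidHom).comap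
          (((unitaryGroupOfForm (galAdicCompletionMap (L := L) (IsCMField.complexConj L) hw) (placeForm (Matrix.of fun i j : Fin 2 => if i.val + j.val + 1 = 2 then (1 : L) else 0) w.1)).subtype.comp
            (localNonsplitEquiv (IsCMField.complexConj L) (Matrix.of fun i j : Fin 2 => if i.val + j.val + 1 = 2 then (1 : L) else 0)
          (IsCMField.complexConj_ne_one L) w hw).toMonoidHom :
            (cmDatum L 2 (Matrix.of fun i j : Fin 2 => if i.val + j.val + 1 = 2 then (1 : L) else 0)).Local v →* GL (Fin 2) (w.1.adicCompletion L)))) ∧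
    z ∈ cmLocalIntegralLevel L 2 (Matrix.of fun i j : Fin 2 => if i.val + j.val + 1 = 2 then (1 : L) else 0) v ∧
    z ∈ (((glInt 2 (w.1.adicCompletion L)).map (MulAut.conj D).toMonoidHom).comap
          (((unitaryGroupOfForm (galAdicCompletionMap (L := L) (IsCMField.complexConj L) hw) (placeForm (Matrix.of fun i j : Fin 2 => if i.val + j.val + 1 = 2 then (1 : L) else 0) w.1)).subtype.comp
            (localNonsplitEquiv (IsCMField.complexConj L) (Matrix.of fun i j : Fin 2 => if i.val + j.val + 1 = 2 then (1 : L) else 0)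
          (IsCMField.complexConj_ne_one L) w hw).toMonoidHom :
            (cmDatum L 2 (Matrix.of fun i j : Fin 2 => if i.val + j.val + 1 = 2 then (1 : L) else 0)).Local v →* GL (Fin 2) (w.1.adicCompletion L)))) ⊓
        cmLocalIntegralLevel L 2 (Matrix.of fun i j : Fin 2 => if i.val + j.val + 1 = 2 then (1 : L) else 0) v := by
  have hc1 : IsCMField.complexConj L ≠ 1 := IsCMField.complexConj_ne_one L
  have hev : (ValuativeRel.valuation (w.1.adicCompletion L)).IsEquiv (Valued.v : Valuation (w.1.adicCompletion L) (WithZero (Multiplicative ℤ))) :=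
    ValuativeRel.isEquiv _ _
  have hJ : placeForm (Matrix.of fun i j : Fin 2 => if i.val + j.val + 1 = 2 then (1 : L) else 0) w.1 = !![(0 : w.1.adicCompletion L), 1; 1, 0] := by
    ext i j; fin_cases i <;> fin_cases j <;> simp [placeForm, Matrix.map_apply]
  set e := localNonsplitEquiv (IsCMField.complexConj L) (Matrix.of fun i j : Fin 2 => if i.val + j.val + 1 = 2 then (1 : L) else 0) (IsCMField.complexConj_ne_one L) w hw with hedef
  set aw : w.1.adicCompletion L := a w with hawdef
  have hg : (((e z : ↥(unitaryGroupOfForm (galAdicCompletionMap (L := L) (IsCMField.complexConj L) hw) (placeForm (Matrix.of fun i j : Fin 2 => if i.val + j.val + 1 = 2 then (1 : L) else 0) w.1))) :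
      GL (Fin 2) (w.1.adicCompletion L)) : Matrix (Fin 2) (Fin 2) (w.1.adicCompletion L)) = aw • (1 : Matrix (Fin 2) (Fin 2) (w.1.adicCompletion L)) := by
    change (((z.val : GL (Fin 2) (LocalRing L v)) : Matrix (Fin 2) (Fin 2) (LocalRing L v)).map
      (Pi.evalRingHom (fun w' : PlacesOver L v => w'.1.adicCompletion L) w)) = aw • (1 : Matrix (Fin 2) (Fin 2) (w.1.adicCompletion L))
    rw [hz]; ext i j
    by_cases hij : i = j <;> simp [Matrix.map_apply, hij, hawdef]
  have hunit := mem_unitaryGroupOfForm_iff.1 (e z).2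
  rw [hg, hJ] at hunit
  have hnorm : galAdicCompletionMap (L := L) (IsCMField.complexConj L) hw aw * aw = 1 := by
    have h01 := congrArg (fun M : Matrix (Fin 2) (Fin 2) (w.1.adicCompletion L) => M 0 1) hunit
    simpa [Matrix.mul_apply, Fin.sum_univ_two, Matrix.map_apply, Matrix.one_apply] using h01
  have hvaw : Valued.v aw = 1 := hev.eq_one_iff_eq_one.1 (valuation_eq_one_of_galAdicCompletionMap_mul_self L v w hw hnorm)
  have hsc : ∀ M : GL (Fin 2) (w.1.adicCompletion L), (M : Matrix (Fin 2) (Fin 2) (w.1.adicCompletion L)) = aw • (1 : Matrix (Fin 2) (Fin 2) (w.1.adicCompletion L)) →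
      M ∈ glInt 2 (w.1.adicCompletion L) := by
    intro M hM
    refine (mem_glInt_iff_forall_v_le_one_and_v_det_eq_one M).2 ⟨fun i j => ?_, ?_⟩
    · rw [hM]; fin_cases i <;> fin_cases j <;> simp [hvaw]
    · rw [hM]; simp [hvaw]
  have hconj : (((D⁻¹ * ((e z : ↥(unitaryGroupOfForm (galAdicCompletionMap (L := L) (IsCMField.complexConj L) hw) (placeForm (Matrix.of fun i j : Fin 2 => if i.val + j.val + 1 = 2 then (1 : L) else 0) w.1))) : GL (Fin 2) (w.1.adicCompletion L)) * D : GL (Fin 2) (w.1.adicCompletion L))) : Matrix (Fin 2) (Fin 2) (w.1.adicCompletion L)) =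
      aw • (1 : Matrix (Fin 2) (Fin 2) (w.1.adicCompletion L)) := by
    rw [Units.val_mul, Units.val_mul, hg, Matrix.mul_smul, Matrix.mul_one, Matrix.smul_mul, Units.inv_mul]
  have hzK : z ∈ cmLocalIntegralLevel L 2 (Matrix.of fun i j : Fin 2 => if i.val + j.val + 1 = 2 then (1 : L) else 0) v :=
    (mem_localIntegralLevel_iff_of_smul_eq (IsCMField.complexConj L) 2 _ hc1 w hw z).2 (hsc _ hg)
  have hzS : z ∈ (((glInt 2 (w.1.adicCompletion L)).map (MulAut.conj D).toMonoidHom).comap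
          (((unitaryGroupOfForm (galAdicCompletionMap (L := L) (IsCMField.complexConj L) hw) (placeForm (Matrix.of fun i j : Fin 2 => if i.val + j.val + 1 = 2 then (1 : L) else 0) w.1)).subtype.comp
            (localNonsplitEquiv (IsCMField.complexConj L) (Matrix.of fun i j : Fin 2 => if i.val + j.val + 1 = 2 then (1 : L) else 0)
          (IsCMField.complexConj_ne_one L) w hw).toMonoidHom :
            (cmDatum L 2 (Matrix.of fun i j : Fin 2 => if i.val + j.val + 1 = 2 then (1 : L) else 0)).Local v →* GL (Fin 2) (w.1.adicCompletion L)))) :=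
    (mem_comap_map_conj_glInt_iff L w hw D z).2 ((Literature.GroupTheory.mem_map_conj_iff _ _ _).2 (hsc _ hconj))
  exact ⟨hzS, hzK, Subgroup.mem_inf.2 ⟨hzS, hzK⟩⟩

variable
  [∀ γ : (cmDatum L 2 (Matrix.of fun i j : Fin 2 => if i.val + j.val + 1 = 2 then (1 : L) else 0)).Local v,
    MeasurableSpace (((cmDatum L 2 (Matrix.of fun i j : Fin 2 => if i.val + j.val + 1 = 2 then (1 : L) else 0)).Local v) ⧸
      Subgroup.centralizer ({γ} : Set ((cmDatum L 2 (Matrix.of fun i j : Fin 2 => if i.val + j.val + 1 = 2 then (1 : L) else 0)).Local v)))]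
  [∀ γ : (cmDatum L 2 (Matrix.of fun i j : Fin 2 => if i.val + j.val + 1 = 2 then (1 : L) else 0)).Local v,
    BorelSpace (((cmDatum L 2 (Matrix.of fun i j : Fin 2 => if i.val + j.val + 1 = 2 then (1 : L) else 0)).Local v) ⧸
      Subgroup.centralizer ({γ} : Set ((cmDatum L 2 (Matrix.of fun i j : Fin 2 => if i.val + j.val + 1 = 2 then (1 : L) else 0)).Local v)))]
  [ν.IsMulRightInvariant]

/-! ## §3 The letter with its negative central value at a ramified place, from (E) and (N) at `(K♯_η, K, K♯_η ⊓ K)` -/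

/-- **(R2♯) AT A RAMIFIED NON-SPLIT PLACE, FROM KOTTWITZ'S RELATIONS.**  `v` ramified in `L`, `η` a uniformiser of `L_w`; given (E) and (N) at the levels
`(K♯_η, K, K♯_η ⊓ K)` (tokens of ★ `exists_epRelations_of_vertexEdgeLevels` at `D := diag(1, η)`), for canonical orbital measures there is a locally constant compactly
supported `f` (Kottwitz's Euler–Poincaré function) with orbital integral `1` on every regular elliptic class, `0` on every regular split class, and the SAME NEGATIVE
VALUE `f(a·1) = −r`, `r > 0`, at every central unit scalar. [cite: Kottwitz1988, §2 Theorem 2] [cite: Rogawski1990, §12.6 p. 174] -/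
theorem exists_isLocSmooth_classOrbitalIntegral_eq_one_zero_and_apply_neg_of_vertexEdgeLevels (he : v.asIdeal.ramificationIdx' w.1.asIdeal ≠ 1)
    (η : (w.1.adicCompletion L)ˣ) (hη : Valued.v (η : w.1.adicCompletion L) = WithZero.exp (-1 : ℤ))
    {m : OrbitalMeasureFamily ((cmDatum L 2 (Matrix.of fun i j : Fin 2 => if i.val + j.val + 1 = 2 then (1 : L) else 0)).Local v)}
    (hm : m.IsCanonical (fun γ => IsRegularElt (γ.val : GL (Fin 2) (UnitaryGroup.LocalRing L v))) ν)
    (hE : ∀ γ : (cmDatum L 2 (Matrix.of fun i j : Fin 2 => if i.val + j.val + 1 = 2 then (1 : L) else 0)).Local v,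
      IsRegularElt (γ.val : GL (Fin 2) (UnitaryGroup.LocalRing L v)) →
      CompactSpace (Subgroup.centralizer ({γ} : Set ((cmDatum L 2 (Matrix.of fun i j : Fin 2 => if i.val + j.val + 1 = 2 then (1 : L) else 0)).Local v))) →
      Nat.card (fixedBy ((cmDatum L 2 (Matrix.of fun i j : Fin 2 => if i.val + j.val + 1 = 2 then (1 : L) else 0)).Local v ⧸
          (((glInt 2 (w.1.adicCompletion L)).map (MulAut.conj (glDiagonal 2 (w.1.adicCompletion L) ![1, η])).toMonoidHom).comap
          (((unitaryGroupOfForm (galAdicCompletionMap (L := L) (IsCMField.complexConj L) hw)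
            (placeForm (Matrix.of fun i j : Fin 2 => if i.val + j.val + 1 = 2 then (1 : L) else 0) w.1)).subtype.comp
            (localNonsplitEquiv (IsCMField.complexConj L) (Matrix.of fun i j : Fin 2 => if i.val + j.val + 1 = 2 then (1 : L) else 0)
          (IsCMField.complexConj_ne_one L) w hw).toMonoidHom :
            (cmDatum L 2 (Matrix.of fun i j : Fin 2 => if i.val + j.val + 1 = 2 then (1 : L) else 0)).Local v →* GL (Fin 2) (w.1.adicCompletion L))))) γ) +
        Nat.card (fixedBy ((cmDatum L 2 (Matrix.of fun i j : Fin 2 => if i.val + j.val + 1 = 2 then (1 : L) else 0)).Local v ⧸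
          cmLocalIntegralLevel L 2 (Matrix.of fun i j : Fin 2 => if i.val + j.val + 1 = 2 then (1 : L) else 0) v) γ) =
        Nat.card (fixedBy ((cmDatum L 2 (Matrix.of fun i j : Fin 2 => if i.val + j.val + 1 = 2 then (1 : L) else 0)).Local v ⧸
          ((((glInt 2 (w.1.adicCompletion L)).map (MulAut.conj (glDiagonal 2 (w.1.adicCompletion L) ![1, η])).toMonoidHom).comap
          (((unitaryGroupOfForm (galAdicCompletionMap (L := L) (IsCMField.complexConj L) hw)
            (placeForm (Matrix.of fun i j : Fin 2 => if i.val + j.val + 1 = 2 then (1 : L) else 0) w.1)).subtype.comp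
            (localNonsplitEquiv (IsCMField.complexConj L) (Matrix.of fun i j : Fin 2 => if i.val + j.val + 1 = 2 then (1 : L) else 0)
          (IsCMField.complexConj_ne_one L) w hw).toMonoidHom :
            (cmDatum L 2 (Matrix.of fun i j : Fin 2 => if i.val + j.val + 1 = 2 then (1 : L) else 0)).Local v →* GL (Fin 2) (w.1.adicCompletion L)))) ⊓
            cmLocalIntegralLevel L 2 (Matrix.of fun i j : Fin 2 => if i.val + j.val + 1 = 2 then (1 : L) else 0) v)) γ) + 1)
    (hN : ∀ γ : (cmDatum L 2 (Matrix.of fun i j : Fin 2 => if i.val + j.val + 1 = 2 then (1 : L) else 0)).Local v,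
      IsRegularElt (γ.val : GL (Fin 2) (UnitaryGroup.LocalRing L v)) →
      ¬ CompactSpace (Subgroup.centralizer ({γ} : Set ((cmDatum L 2 (Matrix.of fun i j : Fin 2 => if i.val + j.val + 1 = 2 then (1 : L) else 0)).Local v))) →
      (((ν ((((glInt 2 (w.1.adicCompletion L)).map (MulAut.conj (glDiagonal 2 (w.1.adicCompletion L) ![1, η])).toMonoidHom).comap
          (((unitaryGroupOfForm (galAdicCompletionMap (L := L) (IsCMField.complexConj L) hw)
            (placeForm (Matrix.of fun i j : Fin 2 => if i.val + j.val + 1 = 2 then (1 : L) else 0) w.1)).subtype.comp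
            (localNonsplitEquiv (IsCMField.complexConj L) (Matrix.of fun i j : Fin 2 => if i.val + j.val + 1 = 2 then (1 : L) else 0)
          (IsCMField.complexConj_ne_one L) w hw).toMonoidHom :
            (cmDatum L 2 (Matrix.of fun i j : Fin 2 => if i.val + j.val + 1 = 2 then (1 : L) else 0)).Local v →* GL (Fin 2) (w.1.adicCompletion L)))))).toReal : ℂ))⁻¹ *
          classOrbitalIntegral m
            ((((((glInt 2 (w.1.adicCompletion L)).map (MulAut.conj (glDiagonal 2 (w.1.adicCompletion L) ![1, η])).toMonoidHom).comap
          (((unitaryGroupOfForm (galAdicCompletionMap (L := L) (IsCMField.complexConj L) hw)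
            (placeForm (Matrix.of fun i j : Fin 2 => if i.val + j.val + 1 = 2 then (1 : L) else 0) w.1)).subtype.comp
            (localNonsplitEquiv (IsCMField.complexConj L) (Matrix.of fun i j : Fin 2 => if i.val + j.val + 1 = 2 then (1 : L) else 0)
          (IsCMField.complexConj_ne_one L) w hw).toMonoidHom :
            (cmDatum L 2 (Matrix.of fun i j : Fin 2 => if i.val + j.val + 1 = 2 then (1 : L) else 0)).Local v →* GL (Fin 2) (w.1.adicCompletion L)))) : Subgroup ((cmDatum L 2 (Matrix.of fun i j : Fin 2 => if i.val + j.val + 1 = 2 then (1 : L) else 0)).Local v)) : Set ((cmDatum L 2 (Matrix.of fun i j : Fin 2 => if i.val + j.val + 1 = 2 then (1 : L) else 0)).Local v)).indicator fun _ => (1 : ℂ))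
            (ConjClasses.mk γ) +
        (((ν (cmLocalIntegralLevel L 2 (Matrix.of fun i j : Fin 2 => if i.val + j.val + 1 = 2 then (1 : L) else 0) v)).toReal : ℂ))⁻¹ *
          classOrbitalIntegral m
            (((cmLocalIntegralLevel L 2 (Matrix.of fun i j : Fin 2 => if i.val + j.val + 1 = 2 then (1 : L) else 0) v) : Set ((cmDatum L 2 (Matrix.of fun i j : Fin 2 => if i.val + j.val + 1 = 2 then (1 : L) else 0)).Local v)).indicator fun _ => (1 : ℂ))
            (ConjClasses.mk γ) -
        (((ν ((((glInt 2 (w.1.adicCompletion L)).map (MulAut.conj (glDiagonal 2 (w.1.adicCompletion L) ![1, η])).toMonoidHom).comap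
          (((unitaryGroupOfForm (galAdicCompletionMap (L := L) (IsCMField.complexConj L) hw)
            (placeForm (Matrix.of fun i j : Fin 2 => if i.val + j.val + 1 = 2 then (1 : L) else 0) w.1)).subtype.comp
            (localNonsplitEquiv (IsCMField.complexConj L) (Matrix.of fun i j : Fin 2 => if i.val + j.val + 1 = 2 then (1 : L) else 0)
          (IsCMField.complexConj_ne_one L) w hw).toMonoidHom :
            (cmDatum L 2 (Matrix.of fun i j : Fin 2 => if i.val + j.val + 1 = 2 then (1 : L) else 0)).Local v →* GL (Fin 2) (w.1.adicCompletion L)))) ⊓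
            cmLocalIntegralLevel L 2 (Matrix.of fun i j : Fin 2 => if i.val + j.val + 1 = 2 then (1 : L) else 0) v)).toReal : ℂ))⁻¹ *
          classOrbitalIntegral m
            ((((((glInt 2 (w.1.adicCompletion L)).map (MulAut.conj (glDiagonal 2 (w.1.adicCompletion L) ![1, η])).toMonoidHom).comap
          (((unitaryGroupOfForm (galAdicCompletionMap (L := L) (IsCMField.complexConj L) hw)
            (placeForm (Matrix.of fun i j : Fin 2 => if i.val + j.val + 1 = 2 then (1 : L) else 0) w.1)).subtype.comp
            (localNonsplitEquiv (IsCMField.complexConj L) (Matrix.of fun i j : Fin 2 => if i.val + j.val + 1 = 2 then (1 : L) else 0)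
          (IsCMField.complexConj_ne_one L) w hw).toMonoidHom :
            (cmDatum L 2 (Matrix.of fun i j : Fin 2 => if i.val + j.val + 1 = 2 then (1 : L) else 0)).Local v →* GL (Fin 2) (w.1.adicCompletion L)))) ⊓
              cmLocalIntegralLevel L 2 (Matrix.of fun i j : Fin 2 => if i.val + j.val + 1 = 2 then (1 : L) else 0) v : Subgroup ((cmDatum L 2 (Matrix.of fun i j : Fin 2 => if i.val + j.val + 1 = 2 then (1 : L) else 0)).Local v)) : Set ((cmDatum L 2 (Matrix.of fun i j : Fin 2 => if i.val + j.val + 1 = 2 then (1 : L) else 0)).Local v)).indicator fun _ => (1 : ℂ))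
            (ConjClasses.mk γ) = 0)
 :
    ∃ f : (cmDatum L 2 (Matrix.of fun i j : Fin 2 => if i.val + j.val + 1 = 2 then (1 : L) else 0)).Local v → ℂ, IsLocSmooth f ∧
      (∀ γ : (cmDatum L 2 (Matrix.of fun i j : Fin 2 => if i.val + j.val + 1 = 2 then (1 : L) else 0)).Local v,
          IsRegularElt (γ.val : GL (Fin 2) (UnitaryGroup.LocalRing L v)) →
          CompactSpace (Subgroup.centralizer ({γ} : Set ((cmDatum L 2 (Matrix.of fun i j : Fin 2 => if i.val + j.val + 1 = 2 then (1 : L) else 0)).Local v))) →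
          classOrbitalIntegral m f (ConjClasses.mk γ) = 1) ∧
      (∀ γ : (cmDatum L 2 (Matrix.of fun i j : Fin 2 => if i.val + j.val + 1 = 2 then (1 : L) else 0)).Local v,
          IsRegularElt (γ.val : GL (Fin 2) (UnitaryGroup.LocalRing L v)) →
          ¬ CompactSpace (Subgroup.centralizer ({γ} : Set ((cmDatum L 2 (Matrix.of fun i j : Fin 2 => if i.val + j.val + 1 = 2 then (1 : L) else 0)).Local v))) →
          classOrbitalIntegral m f (ConjClasses.mk γ) = 0) ∧
      ∃ r : ℝ, 0 < r ∧ ∀ (z : (cmDatum L 2 (Matrix.of fun i j : Fin 2 => if i.val + j.val + 1 = 2 then (1 : L) else 0)).Local v) (a : LocalRing L v),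
          ((z.val : GL (Fin 2) (LocalRing L v)).val : Matrix (Fin 2) (Fin 2) (LocalRing L v)) = a • (1 : Matrix (Fin 2) (Fin 2) (LocalRing L v)) →
          f z = -(r : ℂ) := by
  obtain ⟨hSc, hSo⟩ := isCompact_isOpen_comap_map_conj_glInt L w hw (glDiagonal 2 (w.1.adicCompletion L) ![1, η])
  obtain ⟨hKc, hKo⟩ := isCompact_isOpen_cmLocalIntegralLevel L 2 (Matrix.of fun i j : Fin 2 => if i.val + j.val + 1 = 2 then (1 : L) else 0) v
  obtain ⟨hIc, hIo⟩ := isCompact_isOpen_comap_map_conj_glInt_inf_cmLocalIntegralLevel L w hw (glDiagonal 2 (w.1.adicCompletion L) ![1, η])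
  obtain ⟨f, hf, h1, h0, r, hr, hval⟩ :=
    exists_isLocSmooth_classOrbitalIntegral_eq_one_zero_and_apply_neg_of_relations L 2 _ v ν
      (UnitaryGroup.antidiagOne_isHermitian L 2) (UnitaryGroup.isUnit_antidiagOne_det L 2).ne_zero hm _ _ _ hSo hSc hKo hKc hIo hIc hE hN
      (toReal_inv_add_toReal_inv_lt_of_ramified L w hw ν he η hη)
  refine ⟨f, hf, h1, h0, r, hr, fun z a hz => ?_⟩
  obtain ⟨hzS, hzK, hzI⟩ := scalar_mem_vertexEdgeLevels L w hw _ z a hz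
  exact hval z hzS hzK hzI

end Ramified

end Literature.NumberTheory.Rogawski1990

end
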